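import Mathlib
import Summits.NavierStokesRegularity.FluidComputer.TransportGalerkinAbcSmoothKill
import Summits.NavierStokesRegularity.FluidComputer.TransportGalerkinClassicalTransfer
import HarnessLib

/-!
# The forced-ABC KILL word FOR CLASSICAL SOLUTIONS OF THE PERTURBED NAVIER–STOKES SYSTEM ON `𝕋³` (instab g21, cell `ns-blowup`, 2026-08-27)

HONEST FRAMING (human ruling D-0035): nothing here is a claim about Navier–Stokes blow-up.
WHAT THIS IS NOT: not NS evidence — a MODEL theorem (forced ABC flow on `𝕋³`, an `H²`-type decay
statement for classical solutions of its perturbation equation) whose load-bearing input is the KILL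
Lyapunov certificate of record (interval stage not commissioned); no number or census word moves. It
says nothing about blow-up, about `ℝ³`, or about kinetic energy (`L²`).

PURPOSE. The KILL twin of `TransportGalerkinAbcClassicalKeep.keep_of_classical_perturbation` (g20,
item 136 (hh)), closing the g20 list. `TransportGalerkinAbcSmoothKill.exists_kill_solution_abc_smooth`
gives THE smooth lattice solution from a basin seed `x` with `‖w t‖ ≤ 2 ε e^{λt}` on `[0, T]` and its
uniqueness among all spatially smooth classical solutions of the lattice ODE keeping the clauses;
`TransportGalerkinClassicalTransfer` shows that the scaled coefficient curve `W s = Λ² 𝓕(u s)` of a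
space–time smooth classical solution `u` of the perturbation equation
`∂ₜu = νΔu − (U·∇)u − (u·∇)U − (u·∇)u − ∇q` about the host `U = abcFlow A B C` (divergence-free
slices, zero mode `0`, smooth real pressures) IS such a solution, and that `W 0` carries the seed
clauses (rapid decay, Leray-fixed, real, divergence-free) for free. Hence:

* `decay_of_classical_perturbation` — certificate (g18's list at levels `≥ K`) + rate block
  (`ω < 2λ ≤ 0`, `ω₁ ≤ λ`) + basin data on the DATUM (`√(M/m) ‖Λ² 𝓕(u 0)‖ < ε`, `4Cε < 1`) ⟹ every
  such classical solution `u` on the window obeys `‖Λ² 𝓕(u t)‖_{ℓ²} ≤ 2 ε e^{λt}` for `t ∈ [0, T]`;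
* `decay_of_classical_perturbation_global` — if `u` solves the equation at every `t > 0`, the same
  bound holds for every `t ≥ 0` (the hypotheses do not involve the window): modulo the KILL
  certificate, a classical perturbation of the forced ABC flow starting in the certified basin slice
  decays exponentially (`λ < 0`) / stays bounded (`λ = 0`) in the `H²`-type norm `‖Λ² 𝓕(·)‖_{ℓ²}`
  for as long as it exists as a classical solution.

Mathlib + the tree files cited; no new definitions.
-/

noncomputable section

open scoped ENNReal NNReal ComplexConjugate InnerProductSpace
open Set Filter Topology

namespace Summit.NavierStokesRegularity.FluidComputer.TransportGalerkinAbcClassicalKill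

open RCLike MeasureTheory UnitAddTorus
open Literature.Analysis.FunctionSpaces Literature.Analysis.FunctionSpaces.Lattice
open Literature.Analysis.FunctionSpaces.Torus Literature.Analysis.FunctionSpaces.EuclideanSpace
open Literature.Analysis.ODE Literature.Analysis.FluidPDE
open Summit.NavierStokesRegularity.FluidComputer.TransportGalerkin
open Summit.NavierStokesRegularity.FluidComputer.TransportGalerkinAbc
open Summit.NavierStokesRegularity.FluidComputer.TransportGalerkinAbcSmoothKill
open Summit.NavierStokesRegularity.FluidComputer.TransportGalerkinClassicalTransfer

/-- **KILL for classical solutions of the perturbed forced-ABC system, on a window**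
(`decay_of_classical_perturbation`): `ν > 0`, `T ≥ 0`, the certificate objects/inequalities at levels
`≥ K` (g18's list verbatim), the rate block `ω < 2λ`, `λ ≤ 0`, `ω₁ ≤ λ`, an amplitude `ε > 0`; and a
perturbation `u : ℝ → 𝕋³ → ℝ³` smooth on `ℝ × 𝕋³` with divergence-free slices of vanishing zero mode,
solving on `(0, T)` the classical perturbation equation about `abcFlow A B C` with smooth real pressures
`q t`, whose DATUM lies in the basin: `√(M/m) ‖Λ² 𝓕(u 0)‖ < ε` and `4Cε < 1`. Then
`‖Λ² 𝓕(u t)‖ ≤ 2 ε e^{λt}` for every `t ∈ [0, T]`. -/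
theorem decay_of_classical_perturbation (K : ℕ) (A B C : ℝ) {ν : ℝ} (hν : 0 < ν) {T : ℝ} (hT : 0 ≤ T)
    {μt : ℝ}
    {G₁ G₂ G : lp (fun _ : (Fin 3 → ℤ) => EuclideanSpace ℂ (Fin 3)) 2 →L[ℝ]
      lp (fun _ : (Fin 3 → ℤ) => EuclideanSpace ℂ (Fin 3)) 2}
    (hG₁ : ∀ x y : lp (fun _ : (Fin 3 → ℤ) => EuclideanSpace ℂ (Fin 3)) 2, ⟪G₁ x, y⟫_ℂ = ⟪x, G₁ y⟫_ℂ)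
    (hG₂ : ∀ x y : lp (fun _ : (Fin 3 → ℤ) => EuclideanSpace ℂ (Fin 3)) 2, ⟪G₂ x, y⟫_ℂ = ⟪x, G₂ y⟫_ℂ)
    (hG : ∀ x y : lp (fun _ : (Fin 3 → ℤ) => EuclideanSpace ℂ (Fin 3)) 2, ⟪G x, y⟫_ℂ = ⟪x, G y⟫_ℂ)
    (hG₁P : ∀ n, ∀ w z : lp (fun _ : (Fin 3 → ℤ) => EuclideanSpace ℂ (Fin 3)) 2,
      ⟪G₁ w, cubeProj (n + K) z⟫_ℂ = ⟪G₁ (cubeProj (n + K) w), z⟫_ℂ)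
    (hG₂P : ∀ n, ∀ w z : lp (fun _ : (Fin 3 → ℤ) => EuclideanSpace ℂ (Fin 3)) 2,
      ⟪G₂ w, cubeProj (n + K) z⟫_ℂ = ⟪G₂ (cubeProj (n + K) w), z⟫_ℂ)
    (hGP : ∀ n, ∀ w z : lp (fun _ : (Fin 3 → ℤ) => EuclideanSpace ℂ (Fin 3)) 2,
      ⟪G w, cubeProj (n + K) z⟫_ℂ = ⟪G (cubeProj (n + K) w), z⟫_ℂ)
    (hG₁pos : ∀ x : lp (fun _ : (Fin 3 → ℤ) => EuclideanSpace ℂ (Fin 3)) 2, 0 ≤ re ⟪G₁ x, x⟫_ℂ)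
    {ω c m₂ M₁ : ℝ} (hc : 0 < c) (hm₂ : 0 < m₂) (hM₁ : 0 ≤ M₁)
    (hm₂' : ∀ x : lp (fun _ : (Fin 3 → ℤ) => EuclideanSpace ℂ (Fin 3)) 2, m₂ * ‖x‖ ^ 2 ≤ re ⟪G₂ x, x⟫_ℂ)
    (hM₁' : ∀ x : lp (fun _ : (Fin 3 → ℤ) => EuclideanSpace ℂ (Fin 3)) 2,
      re ⟪G₁ x, x⟫_ℂ ≤ M₁ * (eNormSq (-1) (⇑x)).toReal)
    {m M ω₁ : ℝ} (hm0 : 0 < m)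
    (hm : ∀ x : lp (fun _ : (Fin 3 → ℤ) => EuclideanSpace ℂ (Fin 3)) 2, m * ‖x‖ ^ 2 ≤ re ⟪G x, x⟫_ℂ)
    (hM : ∀ x : lp (fun _ : (Fin 3 → ℤ) => EuclideanSpace ℂ (Fin 3)) 2, re ⟪G x, x⟫_ℂ ≤ M * ‖x‖ ^ 2)
    (h₁ : ∀ n, ∀ w : lp (fun _ : (Fin 3 → ℤ) => EuclideanSpace ℂ (Fin 3)) 2,
      2 * re ⟪G₁ (cubeProj (n + K) w), linOp ν (mFourierCoeff (EuclideanSpace.complexify ∘ Torus.abcFlow A B C))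
        (fun j => (EuclideanSpace.proj j : EuclideanSpace ℂ (Fin 3) →L[ℂ] ℂ)) lerayCLM (cubeProj (n + K) w)⟫_ℂ +
        c * re ⟪G₂ (cubeProj (n + K) w), cubeProj (n + K) w⟫_ℂ ≤ 2 * ω * re ⟪G₁ (cubeProj (n + K) w), cubeProj (n + K) w⟫_ℂ)
    (h₂ : ∀ n, ∀ w : lp (fun _ : (Fin 3 → ℤ) => EuclideanSpace ℂ (Fin 3)) 2,
      re ⟪G₂ (cubeProj (n + K) w), linOp ν (mFourierCoeff (EuclideanSpace.complexify ∘ Torus.abcFlow A B C))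
        (fun j => (EuclideanSpace.proj j : EuclideanSpace ℂ (Fin 3) →L[ℂ] ℂ)) lerayCLM (cubeProj (n + K) w)⟫_ℂ ≤
        ω * re ⟪G₂ (cubeProj (n + K) w), cubeProj (n + K) w⟫_ℂ)
    (hL : ∀ n, ∀ w : lp (fun _ : (Fin 3 → ℤ) => EuclideanSpace ℂ (Fin 3)) 2,
      re ⟪G (cubeProj (n + K) w), linOp ν (mFourierCoeff (EuclideanSpace.complexify ∘ Torus.abcFlow A B C))
        (fun j => (EuclideanSpace.proj j : EuclideanSpace ℂ (Fin 3) →L[ℂ] ℂ)) lerayCLM (cubeProj (n + K) w)⟫_ℂ ≤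
        ω₁ * re ⟪G (cubeProj (n + K) w), cubeProj (n + K) w⟫_ℂ)
    (hμ₁ : μt ≤ ω₁) (hμ₂ : μt ≤ ω)
    (htail : ∀ n, ∀ q : lp (fun _ : (Fin 3 → ℤ) => EuclideanSpace ℂ (Fin 3)) 2, cubeProj (n + K) q = 0 →
      2 * μt * re ⟪G₁ q, q⟫_ℂ + c * re ⟪G₂ q, q⟫_ℂ ≤ 2 * ω * re ⟪G₁ q, q⟫_ℂ)
    {lam : ℝ} (hgap : ω < 2 * lam) (hlam : lam ≤ 0) (hrate : ω₁ ≤ lam)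
    {ε : ℝ} (hε : 0 < ε)
    -- every classical solution of the perturbed system whose datum lies in the basin
    {u : ℝ → UnitAddTorus (Fin 3) → EuclideanSpace ℝ (Fin 3)} (hu : IsSmoothSpaceTimeOn univ u)
    (hdiv : ∀ s, IsDivFree (u s)) (h0 : ∀ s, mFourierCoeff (complexify ∘ u s) 0 = 0)
    {q : ℝ → UnitAddTorus (Fin 3) → ℝ} (hq : ∀ t ∈ Ioo 0 T, IsSmooth (q t))
    (heq : ∀ t ∈ Ioo 0 T, ∀ y, Torus.timeDeriv u t y = ν • laplacian (u t) y
      - (Torus.convect (Torus.abcFlow A B C) (u t) y + Torus.convect (u t) (Torus.abcFlow A B C) y)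
      - Torus.convect (u t) (u t) y - Torus.gradient (q t) y)
    (hseed : Real.sqrt (M / m) *
      ‖(ofCoeff (wmul 2 (mFourierCoeff (complexify ∘ u 0))) : lp (fun _ : (Fin 3 → ℤ) => EuclideanSpace ℂ (Fin 3)) 2)‖ < ε)
    (hbasin : 4 * (Real.sqrt (M₁ / (c * m₂)) * (2 * ((Fintype.card (Fin 3) : ℝ) * (2 * Real.pi)) *
        Real.sqrt ((∑' l : Fin 3 → ℤ, ENNReal.ofReal (sobolevWeight (-2) l ^ 2)).toReal)) *
        Real.sqrt (Real.pi / (2 * lam - ω))) * ε < 1)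
    {t : ℝ} (ht : t ∈ Icc 0 T) :
    ‖(ofCoeff (wmul 2 (mFourierCoeff (complexify ∘ u t))) : lp (fun _ : (Fin 3 → ℤ) => EuclideanSpace ℂ (Fin 3)) 2)‖ ≤
      2 * (ε * Real.exp (lam * t)) := by
  -- the datum carries the seed clauses for free
  have hxr := rapidDecay_coeffCurve hu 0
  obtain ⟨hxfix, hxreal, hxdiv⟩ := coeffCurve_clauses hu hdiv h0 0
  -- THE smooth lattice solution from the datum, its decay, its uniqueness among smooth solutions
  obtain ⟨w, -, -, -, -, -, -, -, -, hdecay, huniq⟩ := exists_kill_solution_abc_smooth K A B C hν hT hxr hxfix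
    hxreal hxdiv hG₁ hG₂ hG hG₁P hG₂P hGP hG₁pos hc hm₂ hM₁ hm₂' hM₁' hm0 hm hM h₁ h₂ hL hμ₁ hμ₂ htail hgap
    hlam hrate hε hseed hbasin
  -- the coefficient curve of `u` is a spatially smooth lattice solution with the clauses
  have hsmoothU : IsSmooth (Torus.abcFlow A B C) := Torus.isSmooth_abcFlow A B C
  have heqOn : EqOn (fun s => (ofCoeff (wmul 2 (mFourierCoeff (complexify ∘ u s))) :
      lp (fun _ : (Fin 3 → ℤ) => EuclideanSpace ℂ (Fin 3)) 2)) w (Icc 0 T) :=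
    huniq (continuous_coeffCurve hu).continuousOn rfl
      (fun s hs => hasDerivAt_coeffCurve_nsField hsmoothU hu hdiv h0 (hq s hs) (heq s hs))
      (fun s _ => rapidDecay_coeffCurve hu s)
      (fun s _ => (coeffCurve_clauses hu hdiv h0 s).1)
      (fun s _ => (coeffCurve_clauses hu hdiv h0 s).2.1)
      (fun s _ => (coeffCurve_clauses hu hdiv h0 s).2.2)
  have h := hdecay t ht
  rw [← heqOn ht] at h
  exact h

/-- **KILL for classical solutions of the perturbed forced-ABC system, globally in time**
(`decay_of_classical_perturbation_global`): under the same certificate, rate block and basin data on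
the datum, a perturbation `u` smooth on `ℝ × 𝕋³` (divergence-free slices, zero mode `0`) solving the
classical perturbation equation about `abcFlow A B C` at EVERY `t > 0` with smooth real pressures obeys
`‖Λ² 𝓕(u t)‖ ≤ 2 ε e^{λt}` for every `t ≥ 0`. -/
theorem decay_of_classical_perturbation_global (K : ℕ) (A B C : ℝ) {ν : ℝ} (hν : 0 < ν)
    {μt : ℝ}
    {G₁ G₂ G : lp (fun _ : (Fin 3 → ℤ) => EuclideanSpace ℂ (Fin 3)) 2 →L[ℝ]
      lp (fun _ : (Fin 3 → ℤ) => EuclideanSpace ℂ (Fin 3)) 2}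
    (hG₁ : ∀ x y : lp (fun _ : (Fin 3 → ℤ) => EuclideanSpace ℂ (Fin 3)) 2, ⟪G₁ x, y⟫_ℂ = ⟪x, G₁ y⟫_ℂ)
    (hG₂ : ∀ x y : lp (fun _ : (Fin 3 → ℤ) => EuclideanSpace ℂ (Fin 3)) 2, ⟪G₂ x, y⟫_ℂ = ⟪x, G₂ y⟫_ℂ)
    (hG : ∀ x y : lp (fun _ : (Fin 3 → ℤ) => EuclideanSpace ℂ (Fin 3)) 2, ⟪G x, y⟫_ℂ = ⟪x, G y⟫_ℂ)
    (hG₁P : ∀ n, ∀ w z : lp (fun _ : (Fin 3 → ℤ) => EuclideanSpace ℂ (Fin 3)) 2,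
      ⟪G₁ w, cubeProj (n + K) z⟫_ℂ = ⟪G₁ (cubeProj (n + K) w), z⟫_ℂ)
    (hG₂P : ∀ n, ∀ w z : lp (fun _ : (Fin 3 → ℤ) => EuclideanSpace ℂ (Fin 3)) 2,
      ⟪G₂ w, cubeProj (n + K) z⟫_ℂ = ⟪G₂ (cubeProj (n + K) w), z⟫_ℂ)
    (hGP : ∀ n, ∀ w z : lp (fun _ : (Fin 3 → ℤ) => EuclideanSpace ℂ (Fin 3)) 2,
      ⟪G w, cubeProj (n + K) z⟫_ℂ = ⟪G (cubeProj (n + K) w), z⟫_ℂ)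
    (hG₁pos : ∀ x : lp (fun _ : (Fin 3 → ℤ) => EuclideanSpace ℂ (Fin 3)) 2, 0 ≤ re ⟪G₁ x, x⟫_ℂ)
    {ω c m₂ M₁ : ℝ} (hc : 0 < c) (hm₂ : 0 < m₂) (hM₁ : 0 ≤ M₁)
    (hm₂' : ∀ x : lp (fun _ : (Fin 3 → ℤ) => EuclideanSpace ℂ (Fin 3)) 2, m₂ * ‖x‖ ^ 2 ≤ re ⟪G₂ x, x⟫_ℂ)
    (hM₁' : ∀ x : lp (fun _ : (Fin 3 → ℤ) => EuclideanSpace ℂ (Fin 3)) 2,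
      re ⟪G₁ x, x⟫_ℂ ≤ M₁ * (eNormSq (-1) (⇑x)).toReal)
    {m M ω₁ : ℝ} (hm0 : 0 < m)
    (hm : ∀ x : lp (fun _ : (Fin 3 → ℤ) => EuclideanSpace ℂ (Fin 3)) 2, m * ‖x‖ ^ 2 ≤ re ⟪G x, x⟫_ℂ)
    (hM : ∀ x : lp (fun _ : (Fin 3 → ℤ) => EuclideanSpace ℂ (Fin 3)) 2, re ⟪G x, x⟫_ℂ ≤ M * ‖x‖ ^ 2)
    (h₁ : ∀ n, ∀ w : lp (fun _ : (Fin 3 → ℤ) => EuclideanSpace ℂ (Fin 3)) 2,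
      2 * re ⟪G₁ (cubeProj (n + K) w), linOp ν (mFourierCoeff (EuclideanSpace.complexify ∘ Torus.abcFlow A B C))
        (fun j => (EuclideanSpace.proj j : EuclideanSpace ℂ (Fin 3) →L[ℂ] ℂ)) lerayCLM (cubeProj (n + K) w)⟫_ℂ +
        c * re ⟪G₂ (cubeProj (n + K) w), cubeProj (n + K) w⟫_ℂ ≤ 2 * ω * re ⟪G₁ (cubeProj (n + K) w), cubeProj (n + K) w⟫_ℂ)
    (h₂ : ∀ n, ∀ w : lp (fun _ : (Fin 3 → ℤ) => EuclideanSpace ℂ (Fin 3)) 2,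
      re ⟪G₂ (cubeProj (n + K) w), linOp ν (mFourierCoeff (EuclideanSpace.complexify ∘ Torus.abcFlow A B C))
        (fun j => (EuclideanSpace.proj j : EuclideanSpace ℂ (Fin 3) →L[ℂ] ℂ)) lerayCLM (cubeProj (n + K) w)⟫_ℂ ≤
        ω * re ⟪G₂ (cubeProj (n + K) w), cubeProj (n + K) w⟫_ℂ)
    (hL : ∀ n, ∀ w : lp (fun _ : (Fin 3 → ℤ) => EuclideanSpace ℂ (Fin 3)) 2,
      re ⟪G (cubeProj (n + K) w), linOp ν (mFourierCoeff (EuclideanSpace.complexify ∘ Torus.abcFlow A B C))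
        (fun j => (EuclideanSpace.proj j : EuclideanSpace ℂ (Fin 3) →L[ℂ] ℂ)) lerayCLM (cubeProj (n + K) w)⟫_ℂ ≤
        ω₁ * re ⟪G (cubeProj (n + K) w), cubeProj (n + K) w⟫_ℂ)
    (hμ₁ : μt ≤ ω₁) (hμ₂ : μt ≤ ω)
    (htail : ∀ n, ∀ q : lp (fun _ : (Fin 3 → ℤ) => EuclideanSpace ℂ (Fin 3)) 2, cubeProj (n + K) q = 0 →
      2 * μt * re ⟪G₁ q, q⟫_ℂ + c * re ⟪G₂ q, q⟫_ℂ ≤ 2 * ω * re ⟪G₁ q, q⟫_ℂ)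
    {lam : ℝ} (hgap : ω < 2 * lam) (hlam : lam ≤ 0) (hrate : ω₁ ≤ lam)
    {ε : ℝ} (hε : 0 < ε)
    -- every global classical solution of the perturbed system whose datum lies in the basin
    {u : ℝ → UnitAddTorus (Fin 3) → EuclideanSpace ℝ (Fin 3)} (hu : IsSmoothSpaceTimeOn univ u)
    (hdiv : ∀ s, IsDivFree (u s)) (h0 : ∀ s, mFourierCoeff (complexify ∘ u s) 0 = 0)
    {q : ℝ → UnitAddTorus (Fin 3) → ℝ} (hq : ∀ t, 0 < t → IsSmooth (q t))
    (heq : ∀ t, 0 < t → ∀ y, Torus.timeDeriv u t y = ν • laplacian (u t) y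
      - (Torus.convect (Torus.abcFlow A B C) (u t) y + Torus.convect (u t) (Torus.abcFlow A B C) y)
      - Torus.convect (u t) (u t) y - Torus.gradient (q t) y)
    (hseed : Real.sqrt (M / m) *
      ‖(ofCoeff (wmul 2 (mFourierCoeff (complexify ∘ u 0))) : lp (fun _ : (Fin 3 → ℤ) => EuclideanSpace ℂ (Fin 3)) 2)‖ < ε)
    (hbasin : 4 * (Real.sqrt (M₁ / (c * m₂)) * (2 * ((Fintype.card (Fin 3) : ℝ) * (2 * Real.pi)) *
        Real.sqrt ((∑' l : Fin 3 → ℤ, ENNReal.ofReal (sobolevWeight (-2) l ^ 2)).toReal)) *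
        Real.sqrt (Real.pi / (2 * lam - ω))) * ε < 1)
    {t : ℝ} (ht : 0 ≤ t) :
    ‖(ofCoeff (wmul 2 (mFourierCoeff (complexify ∘ u t))) : lp (fun _ : (Fin 3 → ℤ) => EuclideanSpace ℂ (Fin 3)) 2)‖ ≤
      2 * (ε * Real.exp (lam * t)) :=
  -- the window `[0, t]` suffices: the hypotheses do not involve the window
  decay_of_classical_perturbation K A B C hν ht hG₁ hG₂ hG hG₁P hG₂P hGP hG₁pos hc hm₂ hM₁ hm₂' hM₁' hm0 hm hM
    h₁ h₂ hL hμ₁ hμ₂ htail hgap hlam hrate hε hu hdiv h0 (fun s hs => hq s hs.1) (fun s hs => heq s hs.1)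
    hseed hbasin ⟨ht, le_rfl⟩

end Summit.NavierStokesRegularity.FluidComputer.TransportGalerkinAbcClassicalKill

end
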